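import Mathlib
import Literature.MathematicalPhysics.QuantumLattice.FermiRG.Salmhofer1998Sec2
import HarnessLib

/-!
# Salmhofer, *Continuous renormalization for fermions and Fermi liquid theory* (CMP 194 (1998) 249):
# §5.2 bounds on the finite-volume propagator (Proposition 4), §5.4 the many-fermion propagator in the
# thermodynamic limit ((5.13), (5.17), Lemma 4's display (5.21)), §5.5 Lemma 5 (`‖Ḋ_t‖ ≤ Δ₂ e^{td}`)

Typer file F7c of the `gate-hubbard-kl` statements-first wave (D-0069 (2); DAG rows `Sal98.P4`,
`Sal98.L5` (+ the display (5.21) of `Sal98.L4` as an aid), HOME/DAG.tsv; the DAG names this file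
`Salmhofer1998Sec4.lean` — it is the §5 file and is named accordingly).  Source: M. Salmhofer, Commun.
Math. Phys. **194** (1998) 249–295, arXiv:cond-mat/9706188 [Salmhofer1998]; locators `p.N Ln` = chunk
`pNNNN.txt` line `n` of the materialised arXiv TeX (`lit read arxiv:cond-mat/9706188`), NOT printed pages;
stable locators are the paper's numbers (Proposition 4, Lemma 4, Lemma 5, equations (5.8)–(5.26) quoted by
content where the render lost the numbers).

WHY.  The tree's `Salmhofer1998.ManyFermionGreenFunctionBound` (Theorem 2, F7b) takes as explicit
hypotheses the three properties of the many-fermion cutoff covariance that the printed proof of Theorem 2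
(p.20 L174–178) invokes: `D_t ≡ 0` beyond `t = log(βε₀)` (Proposition 4), `∫|D̂_t| ≤ 8J₁ε_t` ((5.21) of
Lemma 4) and `‖Ḋ_t‖ ≤ Δ₂ e^{td}` (Lemma 5).  This file types the OBJECTS those properties speak about —
the scale `ε_t` (5.8), the cutoff function `χ₁` of (4.?) (p.15 L125–134), the finite-volume Fourier-space
propagator `D̂_t(k) = χ₁(ε_t⁻²|iω̂ - E(𝐤)|²)/(iω̂ - E(𝐤))` (5.9) on `Λ* = 𝕄_{n_τ} × Λ_s*`, the step function
`ω_β` (5.13), the kernel `𝒞_t(x,y)` (5.17), the thermodynamic-limit propagator `D̂_t(p) = 𝒞_t(ω_β(p₀),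
E(𝐩))` and its position-space `t`-derivative `Ḋ_t(x₀,𝐱)` (5.23) — and states **Proposition 4** (licence
F-083, `FiniteVolumePropagatorBounds`) and **Lemma 5** (licence F-086, `DotCovarianceL1Bound`) as named
facts, plus the display (5.21) as a `Prop`-valued predicate `Display521` (NOT a fact: Lemma 4's constant
`J₁` is the angular Jacobian mass (2.?) `\Jdef` of the low-energy chart `π`, p.7 L3–9, an object not built
here; the predicate records the inequality shape a consumer assumes, exactly like the hypothesis of
`ManyFermionGreenFunctionBound`).

STANDING ASSUMPTIONS OF §5 carried as hypotheses (never asserted): the §2.3 class of models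
(`ModelData.Hyp`, F7b), `βε₀ ≥ 6` and `ε₀ ≤ 1` (p.7 L12–14), `n_τ` even (p.5 L110) with
`n_τ ≥ 2β(ε₀ + E_max)` (§5 ¶3, p.17 L37–40 — this is what makes Lemma 9 = "Lemma (LemA1)" available with
`E = ε_t` for all `t ≥ 0`), and the flow range `t ≥ 0` (p.18 L19–25).  Proposition 4 is a FINITE-VOLUME
statement (finite `n_τ, L`; Remark 6); Lemma 5 and (5.21) are thermodynamic-limit statements (continuous
`p₀` via `ω_β`, `𝐩 ∈ 𝓑`, `𝐱 ∈ εℤ^d`; Remark 8: "this proof changes in finite volume").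

No `instance`, no `notation`; nothing about the Hubbard model is asserted or denied; no sorry/axiom.
Lemma 4 itself (F-085; derivative bounds (5.18)–(5.20) with constants `B_α` and `J₁`) is NOT typed.
-/

noncomputable section

open MeasureTheory Filter
open scoped Topology ENNReal

namespace Literature.MathematicalPhysics.QuantumLattice.FermiRG

namespace Salmhofer1998

variable {d : ℕ}

/-! ### §5.2 The scale `ε_t`, the cutoff function `χ₁`, the finite-volume propagator (5.9) -/

/-- **(5.8)** `ε_t = ε₀ e^{-t}`, the decreasing energy scale parametrising the flow (`t ≥ 0`, limit of
interest `t → ∞`). `Sal98.P4` · Salmhofer 1998 (5.8) · p.18 L19–25.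
[cite: Salmhofer1998, §5.2 (5.8) (p.18 L19–25)] -/
def epsT (eps0 t : ℝ) : ℝ := eps0 * Real.exp (-t)

/-- **The cutoff function `χ₁` of the partition of unity `χ₁ + χ₂ = 1`** (p.15 L125–134), as a predicate
on a candidate `χ₁ : ℝ → ℝ` (never asserted): `χ₁ ∈ C^∞(ℝ₀⁺, [0,1])`, `χ₁(x) = 1` for `x ≤ 1/4`, `χ₁(x) = 0`
for `x ≥ 1`, `χ₁'(x) < 0` on `(1/4, 1)`, `‖χ₁'‖_∞ ≤ 2` (`χ₂ = 1 - χ₁` needs no separate datum).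
`Sal98.P4` · Salmhofer 1998 §4.1 (4.?) `\zerleg` · p.15 L125–134.
[cite: Salmhofer1998, §4.1 (p.15 L125–134)] -/
structure IsCutoff (χ₁ : ℝ → ℝ) : Prop where
  smooth : ContDiffOn ℝ ((⊤ : ℕ∞) : WithTop ℕ∞) χ₁ (Set.Ici 0)
  mem_Icc : ∀ x : ℝ, 0 ≤ x → χ₁ x ∈ Set.Icc (0 : ℝ) 1
  eq_one : ∀ x : ℝ, 0 ≤ x → x ≤ 1 / 4 → χ₁ x = 1
  eq_zero : ∀ x : ℝ, 1 ≤ x → χ₁ x = 0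
  deriv_neg : ∀ x ∈ Set.Ioo (1 / 4 : ℝ) 1, deriv χ₁ x < 0
  deriv_bound : ∀ x : ℝ, 0 < x → |deriv χ₁ x| ≤ 2

/-- `ε_τ = β / n_τ`, the time-lattice spacing (p.5 L101). [cite: Salmhofer1998, §2.1 (p.5 L101)] -/
def epsTau (β : ℝ) (nτ : ℕ) : ℝ := β / nτ

/-- **`ω̂ = (e^{iε_τ ω} - 1)/(iε_τ)`** ((2.?) `\Hatomdef`, p.6 L95–97), the symbol of the discrete time
derivative; `ω̂ → ω` as `ε_τ → 0`. [cite: Salmhofer1998, §2.2 (p.6 L95–97)] -/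
def omegaHat (ετ ω : ℝ) : ℂ :=
  (Complex.exp (Complex.I * ((ετ * ω : ℝ) : ℂ)) - 1) / (Complex.I * (ετ : ℂ))

/-- The Matsubara frequency `ω_n = (π/β)(2n+1)` (p.6 L75–79; (5.12) p.18 L128–131).
[cite: Salmhofer1998, §2.2 (p.6 L75–79)] -/
def matsFreq (β : ℝ) (n : ℤ) : ℝ := Real.pi / β * (2 * n + 1)

/-- The index set of `𝕄_{n_τ} = {ω_n : -n_τ/2 ≤ n < n_τ/2}` (`n_τ` even, p.5 L110; p.6 L75–79).
[cite: Salmhofer1998, §2.2 (p.6 L75–79)] -/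
def matsIdx (nτ : ℕ) : Finset ℤ := Finset.Ico (-((nτ / 2 : ℕ) : ℤ)) ((nτ / 2 : ℕ) : ℤ)

/-- `∫_{Λ*} dp F(p) = (1/β) Σ_{ω ∈ 𝕄_{n_τ}} ∫_{Λ_s*} d𝐩 F(ω,𝐩)`, `∫_{Λ_s*} d𝐩 = L^{-d} Σ_{𝐩 ∈ Λ_s*}`
(p.6 L80–83), the spatial dual lattice listed by `latticeMom` (F7b). For real integrands.
[cite: Salmhofer1998, §2.2 (p.6 L80–83)] -/
def momSum (β latt : ℝ) (nτ L : ℕ) (F : ℝ → Mom d → ℝ) : ℝ :=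
  β⁻¹ * ∑ n ∈ matsIdx nτ, ((L : ℝ) ^ d)⁻¹ * ∑ q : Fin d → Fin L, F (matsFreq β n) (latticeMom latt L q)

/-- `iω̂ - E(𝐤)`, the denominator of the propagator (2.?) `\mfprop1` (p.6 L120–126) at `k = (ω, 𝐤)`.
[cite: Salmhofer1998, §2.2 (p.6 L120–126)] -/
def propDenom (M : ModelData d) (β : ℝ) (nτ : ℕ) (ω : ℝ) (k : Mom d) : ℂ :=
  Complex.I * omegaHat (epsTau β nτ) ω - (M.E k : ℂ)

/-- **(5.9)** the finite-volume cutoff propagator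
`D̂_t(k) = χ₁(ε_t⁻² |iω̂ - E(𝐤)|²) / (iω̂ - E(𝐤))`, `k = (ω, 𝐤) ∈ Λ*` (typed for all real `ω`; read on
`𝕄_{n_τ} × Λ_s*`). `Sal98.P4` · Salmhofer 1998 (5.9) · p.18 L27–36.
[cite: Salmhofer1998, §5.2 (5.9) (p.18 L27–36)] -/
def cutoffCov (M : ModelData d) (χ₁ : ℝ → ℝ) (β : ℝ) (nτ : ℕ) (t ω : ℝ) (k : Mom d) : ℂ :=
  (χ₁ ((epsT M.eps0 t)⁻¹ ^ 2 * ‖propDenom M β nτ ω k‖ ^ 2) : ℂ) / propDenom M β nτ ω k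

/-- `Ḋ̂_t = ∂D̂_t/∂t` (p.18 L40–41), the `t`-derivative of (5.9) at fixed `k`.
`Sal98.P4` · Salmhofer 1998 §5.2 · p.18 L40–41. [cite: Salmhofer1998, §5.2 (p.18 L40–41)] -/
def cutoffCovDot (M : ModelData d) (χ₁ : ℝ → ℝ) (β : ℝ) (nτ : ℕ) (t ω : ℝ) (k : Mom d) : ℂ :=
  deriv (fun s : ℝ => cutoffCov M χ₁ β nτ s ω k) t

/-- The indicator `1(|iω̂ - E(𝐤)| ≤ ε_t)` of Proposition 4 (p.18 L41–43: `1(A) = 1` if `A` is true and `0`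
otherwise). [cite: Salmhofer1998, §5.2 (p.18 L41–43)] -/
def shellInd (M : ModelData d) (β : ℝ) (nτ : ℕ) (t ω : ℝ) (k : Mom d) : ℝ :=
  if ‖propDenom M β nτ ω k‖ ≤ epsT M.eps0 t then 1 else 0

/-- **Proposition 4 (p.18 L45–75), bounds on the finite-volume propagator**, as printed, under the
standing assumptions of §5 made explicit (the §2.3 class of models; `βε₀ ≥ 6`; `n_τ` even with
`n_τ ≥ 2β(ε₀ + E_max)`, `E_max` any bound of `|E|`, p.17 L37–40; `V₁` the constant of (2.?) `\Vobou`,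
`L'^{-d} #{𝐤 ∈ Λ_s* : |E(𝐤)| ≤ 2} ≤ V₁` for all `L'`; flow times `t ≥ 0`), for the propagator (5.9) read on
`Λ* = 𝕄_{n_τ} × Λ_s*`: (a) `t ↦ D̂_t(k)` is `C^∞`; (b) `D̂_t ≡ 0` if `t > log(βε₀/2)`; (c) if
`t ≤ log(βε₀/2)`: `supp D̂_t ⊆ {|iω̂ - E| ≤ ε_t}`, `supp Ḋ̂_t ⊆ {ε_t/2 ≤ |iω̂ - E| ≤ ε_t}`; (d)
`|Ḋ̂_t(k)| ≤ 4ε_t⁻¹ 1(|iω̂-E| ≤ ε_t) ≤ 2β 1(|iω̂-E| ≤ ε_t)`, `|D̂_t(k)| ≤ (β/2) 1(|iω̂-E| ≤ ε_t)`; (e)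
`∫_{Λ*} dk |Ḋ̂_t(k)| ≤ 4V₁` and `∫_{Λ*} dk |D̂_t(k)| ≤ V₁ log(βε₀/2)`.  (For `t > log(βε₀/2)` (d)–(e) hold
trivially by (b).)  Named fact (licence F-083). `Sal98.P4` · Salmhofer 1998 Proposition 4 · p.18 L45–75.
[cite: Salmhofer1998, Proposition 4 (p.18 L45–75)] -/
def FiniteVolumePropagatorBounds : Prop :=
  ∀ (d : ℕ) (M : ModelData d), M.Hyp →
  ∀ (χ₁ : ℝ → ℝ), IsCutoff χ₁ →
  ∀ (Emax V₁ β : ℝ) (nτ L : ℕ),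
    (∀ p : Mom d, |M.E p| ≤ Emax) →
    (∀ L' : ℕ, 0 < L' →
      ((Finset.univ.filter fun q : Fin d → Fin L' => |M.E (latticeMom M.latt L' q)| ≤ 2).card : ℝ) /
          (L' : ℝ) ^ d ≤ V₁) →
    0 < β → 6 ≤ β * M.eps0 → Even nτ → 0 < nτ → 2 * β * (M.eps0 + Emax) ≤ nτ → 0 < L →
    let T : ℝ := Real.log (β * M.eps0 / 2)
    -- (a) smoothness in `t`
    (∀ n ∈ matsIdx nτ, ∀ q : Fin d → Fin L,
      ContDiff ℝ ((⊤ : ℕ∞) : WithTop ℕ∞)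
        fun t : ℝ => cutoffCov M χ₁ β nτ t (matsFreq β n) (latticeMom M.latt L q)) ∧
    -- (b) vanishing beyond `log(βε₀/2)`
    (∀ t : ℝ, T < t → ∀ n ∈ matsIdx nτ, ∀ q : Fin d → Fin L,
      cutoffCov M χ₁ β nτ t (matsFreq β n) (latticeMom M.latt L q) = 0) ∧
    -- (c) supports for `0 ≤ t ≤ log(βε₀/2)`
    (∀ t : ℝ, 0 ≤ t → t ≤ T → ∀ n ∈ matsIdx nτ, ∀ q : Fin d → Fin L,
      let ω := matsFreq β n
      let k := latticeMom M.latt L q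
      (cutoffCov M χ₁ β nτ t ω k ≠ 0 → ‖propDenom M β nτ ω k‖ ≤ epsT M.eps0 t) ∧
      (cutoffCovDot M χ₁ β nτ t ω k ≠ 0 →
        epsT M.eps0 t / 2 ≤ ‖propDenom M β nτ ω k‖ ∧ ‖propDenom M β nτ ω k‖ ≤ epsT M.eps0 t)) ∧
    -- (d) pointwise bounds, `t ≥ 0`
    (∀ t : ℝ, 0 ≤ t → ∀ n ∈ matsIdx nτ, ∀ q : Fin d → Fin L,
      let ω := matsFreq β n
      let k := latticeMom M.latt L q
      ‖cutoffCovDot M χ₁ β nτ t ω k‖ ≤ 4 * (epsT M.eps0 t)⁻¹ * shellInd M β nτ t ω k ∧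
      4 * (epsT M.eps0 t)⁻¹ * shellInd M β nτ t ω k ≤ 2 * β * shellInd M β nτ t ω k ∧
      ‖cutoffCov M χ₁ β nτ t ω k‖ ≤ β / 2 * shellInd M β nτ t ω k) ∧
    -- (e) integral bounds, `t ≥ 0`
    (∀ t : ℝ, 0 ≤ t →
      momSum β M.latt nτ L (fun ω k => ‖cutoffCovDot M χ₁ β nτ t ω k‖) ≤ 4 * V₁ ∧
      momSum β M.latt nτ L (fun ω k => ‖cutoffCov M χ₁ β nτ t ω k‖) ≤ V₁ * T)

/-! ### §5.4 The many-fermion propagator in the thermodynamic limit -/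

/-- **(5.13)** the step function `ω_β : ℝ → 𝕄(β)`, `ω_β(p₀) = (π/β)(2n+1)` if
`p₀ ∈ (2πn/β, 2π(n+1)/β]`, i.e. `n = ⌈βp₀/(2π)⌉ - 1` (so that `∫_ℝ dp₀/(2π) f(ω_β(p₀)) = β⁻¹ Σ_{ω ∈ 𝕄(β)} f(ω)`,
(5.14)). `Sal98.L5` · Salmhofer 1998 (5.13) · p.19 L93–98.
[cite: Salmhofer1998, §5.4 (5.13)–(5.14) (p.19 L93–105)] -/
def omegaStep (β p₀ : ℝ) : ℝ := matsFreq β (⌈β * p₀ / (2 * Real.pi)⌉ - 1)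

/-- **(5.17)** `𝒞_t(x,y) = χ₁(ε_t⁻²(x² + y²)) / (ix - y)`, so that the thermodynamic-limit propagator is
`D̂_t(p) = 𝒞_t(ω_β(p₀), E(𝐩))` (p.19 L119–124). `Sal98.L5` · Salmhofer 1998 (5.17) · p.19 L119–124.
[cite: Salmhofer1998, §5.4 (5.17) (p.19 L119–124)] -/
def covC (χ₁ : ℝ → ℝ) (eps0 t x y : ℝ) : ℂ :=
  (χ₁ ((epsT eps0 t)⁻¹ ^ 2 * (x ^ 2 + y ^ 2)) : ℂ) / (Complex.I * (x : ℂ) - (y : ℂ))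

/-- `𝒞̇_t = ∂𝒞_t/∂t` (`= -(2/ε_t²)(ix + y) χ₁'((x²+y²)/ε_t²)`, p.20 L5–6, L80–82), typed as the
`t`-derivative. `Sal98.L5` · Salmhofer 1998 §5.4–5.5 · p.20 L5–6, L80–82.
[cite: Salmhofer1998, §5.4 (p.20 L5–6) and §5.5 (p.20 L80–82)] -/
def covCDot (χ₁ : ℝ → ℝ) (eps0 t x y : ℝ) : ℂ :=
  deriv (fun s : ℝ => covC χ₁ eps0 s x y) t

/-- The thermodynamic-limit cutoff propagator `D̂_t(p) = 𝒞_t(ω_β(p₀), E(𝐩))`, `p = (p₀, 𝐩) ∈ ℝ × 𝓑`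
(p.19 L119–121). `Sal98.L5` · Salmhofer 1998 §5.4 · p.19 L119–121.
[cite: Salmhofer1998, §5.4 (p.19 L119–121)] -/
def cutoffCovInf (M : ModelData d) (χ₁ : ℝ → ℝ) (β t p₀ : ℝ) (p : Mom d) : ℂ :=
  covC χ₁ M.eps0 t (omegaStep β p₀) (M.E p)

/-- The fundamental domain `[-π/ε, π/ε)^d` of the Brillouin zone `𝓑 = ℝ^d / (2π/ε)ℤ^d` of the lattice
`εℤ^d` (p.6 L142–144), over which `∫_𝓑 d^d𝐩/(2π)^d` is taken. [cite: Salmhofer1998, §2.3 (p.6 L142–144)] -/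
def bzBox (d : ℕ) (latt : ℝ) : Set (Mom d) :=
  Set.pi Set.univ fun _ => Set.Ico (-(Real.pi / latt)) (Real.pi / latt)

/-- The left side of (5.21): `∫_{ℝ×𝓑} d^{d+1}p/(2π)^{d+1} |D̂_t(p)|` (an `ℝ≥0∞`-valued Lebesgue integral over
`ℝ × [-π/ε, π/ε)^d`; no junk value). `Sal98.L4` · Salmhofer 1998 (5.21) · p.19 (last display of Lemma 4).
[cite: Salmhofer1998, Lemma 4 (5.21) (p.19 L160–166)] -/
def covL1Momentum (M : ModelData d) (χ₁ : ℝ → ℝ) (β t : ℝ) : ℝ≥0∞ :=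
  ENNReal.ofReal (((2 * Real.pi) ^ (d + 1))⁻¹) *
    ∫⁻ p in (Set.univ : Set ℝ) ×ˢ bzBox d M.latt, ‖cutoffCovInf M χ₁ β t p.1 p.2‖ₑ

/-- **Display (5.21) of Lemma 4** as a `Prop`-valued predicate (an AID, not a fact):
`∫_{ℝ×𝓑} d^{d+1}p/(2π)^{d+1} |D̂_t(p)| ≤ 8 J₁ ε_t`.  In print `J₁ = sup_{|ρ| ≤ ε₀} ∫_{S^{d-1}} dθ |J(ρ,θ)|` is
the angular mass of the Jacobian `J = det π'` of the low-energy chart `π` ((2.?) `\Jdef`, p.7 L3–9), an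
object this file does not build; its only use in the printed proof is the volume bound
`∫_𝓑 d^d𝐩/(2π)^d 1(|E(𝐩)| ≤ ε) ≤ 2J₁ε` (p.20 L28–34).  Lemma 4 (p.19 L132 – p.20 L36) asserts this display
for `t ≤ log(βε₀/π)` (and `D̂_t ≡ 0` beyond).  A consumer takes `(h : ∀ t ≥ 0, Display521 M χ₁ β J₁ t)`,
cf. the hypothesis `∫|D̂_t| ≤ 8J₁ε₀e^{-t}` of `ManyFermionGreenFunctionBound` (F7b).
`Sal98.L4` · Salmhofer 1998 Lemma 4 (5.21) · p.19 L160–166. [cite: Salmhofer1998, Lemma 4 (5.21) (p.19 L132 – p.20 L36)] -/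
def Display521 (M : ModelData d) (χ₁ : ℝ → ℝ) (β J₁ t : ℝ) : Prop :=
  covL1Momentum M χ₁ β t ≤ ENNReal.ofReal (8 * J₁ * epsT M.eps0 t)

/-! ### §5.5 Lemma 5: the position-space bound `‖Ḋ_t‖ ≤ Δ₂ e^{td}` -/

/-- **(5.23)** the position-space `t`-derivative of the propagator,
`Ḋ_t(x₀,𝐱) = ∫_ℝ dk₀/(2π) ∫_𝓑 d^d𝐤/(2π)^d e^{i x₀ ω_β(k₀) + i𝐤·𝐱} 𝒞̇_t(ω_β(k₀), E(𝐤))` (the `k₀`-integral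
is the Matsubara sum, (5.14); the integrand is a finitely supported step function in `k₀`).
`Sal98.L5` · Salmhofer 1998 (5.23) · p.20 L70–75. [cite: Salmhofer1998, Lemma 5 (5.23) (p.20 L70–75)] -/
def dotCovPos (M : ModelData d) (χ₁ : ℝ → ℝ) (β t x₀ : ℝ) (x : Mom d) : ℂ :=
  ∫ k₀ : ℝ, ((2 * Real.pi)⁻¹ : ℝ) •
    ∫ k in bzBox d M.latt, (((2 * Real.pi) ^ d)⁻¹ : ℝ) •
      (Complex.exp (Complex.I * ((x₀ * omegaStep β k₀ + ∑ i, k i * x i : ℝ) : ℂ)) *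
        covCDot χ₁ M.eps0 t (omegaStep β k₀) (M.E k))

/-- The printed majorant of `‖Ḋ_t‖` (p.20 L66–68, "by definition of `‖·‖`"):
`4 ∫_{-β/2}^{β/2} dx₀ ∫_{Λ_s} d𝐱 |Ḋ_t(x₀,𝐱)|` with `∫_{Λ_s} d𝐱 = ε^d Σ_{𝐱 ∈ εℤ^d}` (p.5 L14) — the norm (4.4)
(`max_p sup_{X_p} ∫ dX' |Ḋ_t(X,X')|`, p.14 L54–61) of the translation-invariant Nambu kernel (5.4)–(5.5)
is this position-space `L¹` norm up to the printed factor.  `ℝ≥0∞`-valued (`∫⁻`, `Σ'`: no junk values).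
`Sal98.L5` · Salmhofer 1998 Lemma 5 proof (5.22) · p.20 L66–68.
[cite: Salmhofer1998, Lemma 5 (p.20 L60–68)] -/
def dotCovL1 (M : ModelData d) (χ₁ : ℝ → ℝ) (β t : ℝ) : ℝ≥0∞ :=
  4 * ∫⁻ x₀ in Set.Icc (-(β / 2)) (β / 2),
    ENNReal.ofReal (M.latt ^ d) * ∑' n : Fin d → ℤ, ‖dotCovPos M χ₁ β t x₀ (fun i => M.latt * (n i : ℝ))‖ₑ

/-- **Lemma 5 (p.20 L60–68)**, as printed: for many-fermion systems (the §2.3 class, cutoff `χ₁` as in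
§4.1) with `E ∈ C^{k₀}`, `k₀ > d`, there is `Δ₂ > 0` such that FOR ALL `t ≥ 0` AND ALL `β` (in the standing
window `βε₀ ≥ 6`): `‖Ḋ_t‖ ≤ Δ₂ e^{td}` — typed on the printed majorant `dotCovL1` (the proof, p.20
L66–104, establishes exactly `dotCovL1 ≤ Δ₂ e^{td}` from the decay claim (5.24); `∃ Δ₂` absorbs the
factor).  Thermodynamic-limit statement (Remark 8, p.20 L158–163: the finite-volume version needs the
Fermi surface to avoid the momentum lattice).  Named fact (licence F-086). `Sal98.L5` · Salmhofer 1998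
Lemma 5 · p.20 L60–68. [cite: Salmhofer1998, Lemma 5 (p.20 L60–68)] -/
def DotCovarianceL1Bound : Prop :=
  ∀ (d : ℕ) (M : ModelData d), M.Hyp → d < M.k0 →
  ∀ (χ₁ : ℝ → ℝ), IsCutoff χ₁ →
    ∃ Δ₂ : ℝ, 0 < Δ₂ ∧
      ∀ β : ℝ, 0 < β → 6 ≤ β * M.eps0 →
        ∀ t : ℝ, 0 ≤ t → dotCovL1 M χ₁ β t ≤ ENNReal.ofReal (Δ₂ * Real.exp (t * d))

/-! ### Unfolding lemmas (proved) -/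

/-- `ε_0 = ε₀`. [cite: Salmhofer1998, §5.2 (5.8) (p.18 L19–25)] -/
theorem epsT_zero (eps0 : ℝ) : epsT eps0 0 = eps0 := by
  simp [epsT]

/-- `ε_t > 0` whenever `ε₀ > 0`. [cite: Salmhofer1998, §5.2 (5.8) (p.18 L19–25)] -/
theorem epsT_pos {eps0 : ℝ} (h : 0 < eps0) (t : ℝ) : 0 < epsT eps0 t :=
  mul_pos h (Real.exp_pos _)

/-- `ε_t ≤ ε₀` for `t ≥ 0` ("For `t ≥ 0`, `ε_t ≤ ε₀`", p.20 L26). [cite: Salmhofer1998, §5.4 (p.20 L26)] -/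
theorem epsT_le {eps0 : ℝ} (h : 0 ≤ eps0) {t : ℝ} (ht : 0 ≤ t) : epsT eps0 t ≤ eps0 := by
  unfold epsT
  have : Real.exp (-t) ≤ 1 := by
    rw [Real.exp_le_one_iff]; linarith
  nlinarith

/-- `ω_β` takes values in the Matsubara set `(π/β)(2ℤ+1)`. [cite: Salmhofer1998, §5.4 (5.13) (p.19 L93–98)] -/
theorem omegaStep_mem (β p₀ : ℝ) : ∃ n : ℤ, omegaStep β p₀ = matsFreq β n :=
  ⟨_, rfl⟩

end Salmhofer1998

end Literature.MathematicalPhysics.QuantumLattice.FermiRG
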